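import Literature.AnabelianGeometry.AbsoluteAnabelian.AbsTopII.TwoTripodNodalMoreover
import HarnessLib

/-!
# [AbsTopII] Prop 1.3 (vii) at the two-vertex nodal DPSC datum: `D_e = C(Π_e) = N(Π_e)` commensurably terminal

S. Mochizuki, *Topics in Absolute Anabelian Geometry II* [AbsTopII] (bib `MochizukiAbsTopII2013`; locators =
PDF pages of the kurims manuscript `paper:url-585b8d0ad0d9`), §1 Prop 1.3 (vii) p. 12 (proof p. 13);
[CombGC] (`MochizukiCombGC2007`) Prop 1.2 (ii) p. 8.

PROOF-ONLY companion of `AbsTopII/TwoTripodNodalDatum.lean` (abc-iut-f-066 gen 5, row «P13-TWO-VERTEX-NODAL-MODEL»),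
part 4 (over parts 1–3 `TwoTripodNodal{Inertia,Node,Moreover}.lean`).  At `M.dpsc` (two tripods `v_A`, `v_B`, ONE
non-loop node `e`, cusps `c₁, c₂ | c₃, c₀`, `I ≅ Ẑ^Σ` acting by the Dehn twist; every `Σ`):

* `decomposition_of_section` — the GENERIC mechanism: for a closed subgroup `K ⊆ Π_𝔾` commensurably terminal in
  `Π_𝔾` and a subgroup `S` centralising `K` with `S · Π_𝔾 = P`, one has
  `C_P(K) = N_P(K) = K · S` (every `x = s·a` with `a ∈ C(K) ∩ Π_𝔾 = K`); if moreover `(K·S) ∩ Π_𝔾 = K`, then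
  `K · S` is commensurably terminal in `P` (`C(K·S) ⊆ C((K·S) ∩ Π_𝔾) = C(K)`);
* `prop13vii_dpsc` — **[AbsTopII] Prop 1.3 (vii) (`DPSCData.Prop13vii`, F-0280) HOLDS at the two-vertex nodal datum,
  no hypothesis**: for the node `D_e = C(Π_e) = Π_e · T` is commensurably terminal and `I_e = D_e ∩ Π_I`; for the
  cusps `D_{c_j} = C(Π_{c_j}) = Π_{c_j} · T` (`j = 1, 2`, the twist fixes `c_j`) resp. `Π_{c_j} · U` (`j = 3, 0`, the
  twist conjugates `c_j` by `c₁c₂`), commensurably terminal — [CombGC] Prop 1.2 (ii) for the edge groups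
  (free-factor / cusp malnormality in the pro-`Σ` completion) + the sections `T`, `U`;
* `exists_twoVertex_nodal_model_vii` — the summary of part 3 extended by (vii).

HONEST FRAMING: instance at a constructed datum (constructed ≠ geometric); no hypothesis; no side taken on
[IUTchIII] Cor 3.12; typed ≠ proved for the print statements about all stable log curves.
-/

noncomputable section

open scoped Pointwise

namespace Literature.AnabelianGeometry.AbsoluteAnabelian.AbsTopII.TwoTripodNodal.Model

open Literature.AnabelianGeometry.SemiGraphs
open Literature.AnabelianGeometry.SemiGraphs.SemiGraphOfAnabelioids (IsProSigmaCompletion)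
open Literature.AnabelianGeometry.SemiGraphs.SemiGraphOfAnabelioids.IsProSigmaCompletion
open Literature.AnabelianGeometry.Anabelioids (IsSigmaInteger normalizer_le_commensurator)
open Literature.GroupTheory.CombinatorialGroupTheory
open Literature.GroupTheory.CombinatorialGroupTheory.PuncturedSurfaceGroup
open _root_.Topology

variable {Sigma : Set ℕ} (M : Model Sigma)

/-! ### The generic mechanism: an edge group and a section centralising it -/

/-- **`C_P(K) ⊆ K · S`** for `K` commensurably terminal in `Π_𝔾` and a section `S` (`S · Π_𝔾 = P`) centralising
`K`: `x = s·a` with `s ∈ S ⊆ Z(K) ⊆ C(K)`, so `a ∈ C(K) ∩ Π_𝔾 = K`. [cite: MochizukiAbsTopII2013, Prop 1.3 (vii) p.12] -/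
theorem commensurator_le_sup_of_section (K S : Subgroup M.P)
    (hK : Subgroup.Commensurable.commensurator K ⊓ M.PiG ≤ K)
    (hS : S ≤ Subgroup.centralizer (K : Set M.P)) (hSG : S ⊔ M.PiG = ⊤) :
    Subgroup.Commensurable.commensurator K ≤ K ⊔ S := by
  haveI : M.PiG.Normal := M.normal_PiG
  intro x hx
  have hx' : x ∈ ((S ⊔ M.PiG : Subgroup M.P) : Set M.P) := by rw [hSG]; exact Subgroup.mem_top x
  rw [Subgroup.mul_normal] at hx'
  obtain ⟨s, hs, a, ha, rfl⟩ := Set.mem_mul.mp hx'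
  have hsC : s ∈ Subgroup.Commensurable.commensurator K :=
    normalizer_le_commensurator _ (Subgroup.centralizer_le_normalizer _ (hS hs))
  have haC : a ∈ Subgroup.Commensurable.commensurator K := by
    have := Subgroup.mul_mem _ (Subgroup.inv_mem _ hsC) hx
    rwa [inv_mul_cancel_left] at this
  exact Subgroup.mul_mem _ (Subgroup.mem_sup_right hs) (Subgroup.mem_sup_left (hK ⟨haC, ha⟩))

/-- **`C_P(K) = N_P(K) = K · S`** under the same hypotheses (`K, S ⊆ N(K) ⊆ C(K) ⊆ K · S`).
[cite: MochizukiAbsTopII2013, Prop 1.3 (vii) p.12] -/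
theorem decomposition_of_section (K S : Subgroup M.P)
    (hK : Subgroup.Commensurable.commensurator K ⊓ M.PiG ≤ K)
    (hS : S ≤ Subgroup.centralizer (K : Set M.P)) (hSG : S ⊔ M.PiG = ⊤) :
    Subgroup.normalizer (K : Set M.P) = K ⊔ S ∧ Subgroup.Commensurable.commensurator K = K ⊔ S := by
  have h1 : K ⊔ S ≤ Subgroup.normalizer (K : Set M.P) :=
    sup_le Subgroup.le_normalizer (le_trans hS (Subgroup.centralizer_le_normalizer _))
  have h2 : Subgroup.normalizer (K : Set M.P) ≤ Subgroup.Commensurable.commensurator K := normalizer_le_commensurator _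
  have h3 := M.commensurator_le_sup_of_section K S hK hS hSG
  exact ⟨le_antisymm (le_trans h2 h3) h1, le_antisymm h3 (le_trans h1 h2)⟩

/-- **`K · S` is commensurably terminal in `P`** if moreover `(K · S) ∩ Π_𝔾 = K`:
`C(K · S) ⊆ C((K · S) ∩ Π_𝔾) = C(K) = K · S`. [cite: MochizukiAbsTopII2013, Prop 1.3 (vii) p.12] -/
theorem isCommensurablyTerminal_sup_of_section (K S : Subgroup M.P)
    (hK : Subgroup.Commensurable.commensurator K ⊓ M.PiG ≤ K)
    (hS : S ≤ Subgroup.centralizer (K : Set M.P)) (hSG : S ⊔ M.PiG = ⊤) (hKS : (K ⊔ S) ⊓ M.PiG = K) :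
    IsCommensurablyTerminal (K ⊔ S) := by
  haveI : M.PiG.Normal := M.normal_PiG
  refine ⟨le_antisymm ?_ (le_trans Subgroup.le_normalizer (normalizer_le_commensurator _))⟩
  calc Subgroup.Commensurable.commensurator (K ⊔ S)
      ≤ Subgroup.Commensurable.commensurator ((K ⊔ S) ⊓ M.PiG) := commensurator_le_commensurator_inf_normal _ _
    _ = Subgroup.Commensurable.commensurator K := by rw [hKS]
    _ ≤ K ⊔ S := M.commensurator_le_sup_of_section K S hK hS hSG

/-- `(K · S) ∩ Π_𝔾 = K` when `K ⊆ Π_𝔾`, `K` centralises `S` and `S ∩ Π_𝔾 = {1}` (`x = k·s ∈ Π_𝔾` forces `s ∈ Π_𝔾`).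
[cite: MochizukiAbsTopII2013, Prop 1.3 (vii) p.12] -/
theorem sup_inf_PiG_eq_of_section (K S : Subgroup M.P) (hKG : K ≤ M.PiG)
    (hS : S ≤ Subgroup.centralizer (K : Set M.P)) (hSbot : S ⊓ M.PiG = ⊥) : (K ⊔ S) ⊓ M.PiG = K := by
  have hle : K ≤ Subgroup.normalizer (S : Set M.P) := fun k hk => by
    rw [Subgroup.mem_normalizer_iff]
    intro s
    constructor
    · intro hs
      have hc : k * s = s * k := Subgroup.mem_centralizer_iff.mp (hS hs) k hk
      rwa [hc, mul_inv_cancel_right]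
    · intro hs
      have hc : k * (k * s * k⁻¹) = k * s * k⁻¹ * k := Subgroup.mem_centralizer_iff.mp (hS hs) k hk
      have : s = k * s * k⁻¹ := by
        calc s = k⁻¹ * ((k * s * k⁻¹) * k) := by group
          _ = k⁻¹ * (k * (k * s * k⁻¹)) := by rw [← hc]
          _ = k * s * k⁻¹ := by rw [inv_mul_cancel_left]
      rw [this]; exact hs
  refine le_antisymm ?_ (le_inf le_sup_left hKG)
  rintro x ⟨hx, hxG⟩
  have hx' : x ∈ ((K ⊔ S : Subgroup M.P) : Set M.P) := hx
  rw [Subgroup.coe_mul_of_left_le_normalizer_right K S hle] at hx'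
  obtain ⟨k, hk, s, hs, rfl⟩ := Set.mem_mul.mp hx'
  have hsG : s ∈ M.PiG := by
    have := M.PiG.mul_mem (M.PiG.inv_mem (hKG hk)) hxG
    rwa [inv_mul_cancel_left] at this
  have hs1 : s = 1 := by rw [← Subgroup.mem_bot, ← hSbot]; exact ⟨hs, hsG⟩
  rw [hs1, mul_one]; exact hk

/-! ### The cusp groups inside `P` -/

/-- `ι(Π_{c_j}) = closure ⟨ι(inl c_j)⟩` inside `P`. [cite: MochizukiAbsTopII2013, Def 1.2 (ii) p.10] -/
theorem cuspGp_map_eq (j : Fin 4) : (M.cuspGp j).map M.PiG.subtype =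
    (Subgroup.zpowers (M.ι (SemidirectProduct.inl (c j : PuncturedSurfaceGroup 0 4)))).topologicalClosure := by
  rw [Model.cuspGp, map_subtype_topologicalClosure, Subgroup.map_map, subtype_comp_κG, PuncturedSurfaceGroup.cuspInertia,
    MonoidHom.map_zpowers, MonoidHom.comp_apply]

/-- `T` centralises `ι(Π_{c_j})` for the cusps `c₁, c₂` fixed by the twist. [cite: MochizukiAbsTopII2013, Prop 1.3 (iii) p.11] -/
theorem T_le_centralizer_cuspGp {j : Fin 4} (hj : M.φ (Multiplicative.ofAdd (1 : ℤ)) (c j) = c j) :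
    M.T ≤ Subgroup.centralizer (((M.cuspGp j).map M.PiG.subtype : Subgroup M.P) : Set M.P) := by
  intro t ht
  rw [Subgroup.mem_centralizer_iff]
  intro y hy
  rw [SetLike.mem_coe, cuspGp_map_eq] at hy
  have hle := M.zpowers_closure_le_centralizer _ t (SemidirectCofinal.centralizes_of_fixed M.φ M.ι hj ht).symm
  exact Subgroup.mem_centralizer_singleton_iff.mp (hle hy)

/-- `U` centralises `ι(Π_{c_j})` for the cusps `c₃, c₀` conjugated by the node element. [cite: MochizukiAbsTopII2013, Prop 1.3 (iii) p.11] -/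
theorem U_le_centralizer_cuspGp {j : Fin 4}
    (hj : M.φ (Multiplicative.ofAdd (1 : ℤ)) (c j) = c 1 * c 2 * c j * (c 1 * c 2)⁻¹) :
    M.U ≤ Subgroup.centralizer (((M.cuspGp j).map M.PiG.subtype : Subgroup M.P) : Set M.P) := by
  intro u hu
  rw [Subgroup.mem_centralizer_iff]
  intro y hy
  rw [SetLike.mem_coe, cuspGp_map_eq] at hy
  have hle := M.zpowers_closure_le_centralizer _ u
    (SemidirectCofinal.centralizes_twisted_of_conj M.φ M.ι (δ := (c 1 * c 2)⁻¹) (by rw [hj, inv_inv]) hu).symm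
  exact Subgroup.mem_centralizer_singleton_iff.mp (hle hy)

/-- `Π_{c}` is commensurably terminal in `Π_𝔾` ([CombGC] Prop 1.2 (ii), cusp malnormality at two-tripod shape).
[cite: MochizukiCombGC2007, Prop 1.2(ii) p.8] -/
theorem isCommensurablyTerminal_cuspSub (hne : Sigma.Nonempty) (hprime : ∀ p ∈ Sigma, p.Prime)
    (e : (M.dpsc hne hprime).Cusp) :
    IsCommensurablyTerminal (((M.dpsc hne hprime).cuspSub e).subgroupOf (M.dpsc hne hprime).PiG) := by
  haveI : CompactSpace ↥M.PiG := isCompact_iff_compactSpace.mp M.isClosed_PiG.isCompact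
  obtain ⟨e', he'⟩ := DPSCData.exists_rangeEquiv (M.pscDatum hne hprime) M.P M.PiG.subtype M.isClosed_range_subtype
    M.normal_range_subtype ⊤ inferInstance le_top continuous_subtype_val Subtype.val_injective
  exact (M.dpsc hne hprime).toDPSCData.isCommensurablyTerminal_cuspSub_of_psc
    ((M.pscDatum hne hprime).mapAlong e'.toMulEquiv.toMonoidHom e'.continuous (M.pscDatum hne hprime).Sigma
      subset_rfl (M.pscDatum hne hprime).sigma_nonempty ((M.pscDatum hne hprime).proSigma.of_continuousMulEquiv e'))
    Equiv.ulift (DPSCData.cuspSub_presentation (M.pscDatum hne hprime) M.P M.PiG.subtype M.isClosed_range_subtype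
      M.normal_range_subtype ⊤ inferInstance le_top he')
    ((PSCDatum.verticialEdgeLikeCommensurablyTerminal_mapAlong_equiv_iff (M.pscDatum hne hprime) e' _ _ _ _).mpr
      (M.verticialEdgeLikeCommensurablyTerminal_pscDatum hne hprime)) e

/-! ### Prop 1.3 (vii) -/

/-- **The node clause of Prop 1.3 (vii)**: `D_e = C(Π_e) = Π_e · T` is commensurably terminal and `I_e = D_e ∩ Π_I`.
[cite: MochizukiAbsTopII2013, Prop 1.3 (vii) p.12] -/
theorem prop13vii_node_dpsc (hne : Sigma.Nonempty) (hprime : ∀ p ∈ Sigma, p.Prime) (e : (M.dpsc hne hprime).Node) :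
    (M.dpsc hne hprime).DvNode e = Subgroup.Commensurable.commensurator ((M.dpsc hne hprime).nodeSub e) ∧
      IsCommensurablyTerminal ((M.dpsc hne hprime).DvNode e) ∧
      (M.dpsc hne hprime).IvNode e = (M.dpsc hne hprime).DvNode e ⊓ (M.dpsc hne hprime).PiI := by
  -- the inputs, in `P`
  have hK : Subgroup.Commensurable.commensurator ((M.nodeGp).map M.PiG.subtype) ⊓ M.PiG ≤ (M.nodeGp).map M.PiG.subtype := by
    have h : Subgroup.Commensurable.commensurator ((M.nodeGp).map M.PiG.subtype) ⊓ M.PiG.subtype.range ≤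
        (M.nodeGp).map M.PiG.subtype :=
      (isCommensurablyTerminal_subgroupOf_iff ((M.dpsc hne hprime).nodeSub_le e)).mp
        (M.isCommensurablyTerminal_nodeSub hne hprime e)
    rwa [Subgroup.range_subtype] at h
  have hS : M.T ≤ Subgroup.centralizer (((M.nodeGp).map M.PiG.subtype : Subgroup M.P) : Set M.P) := fun t ht => by
    rw [Subgroup.mem_centralizer_iff]
    intro a ha
    exact M.W_commute_T a ha t ht
  have hSG : M.T ⊔ M.PiG = ⊤ := by rw [sup_comm]; exact M.PiG_sup_T
  obtain ⟨hN, hC⟩ := M.decomposition_of_section _ _ hK hS hSG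
  have hKS : ((M.nodeGp).map M.PiG.subtype ⊔ M.T) ⊓ M.PiG = (M.nodeGp).map M.PiG.subtype :=
    M.sup_inf_PiG_eq_of_section _ _ (Subgroup.map_subtype_le _) hS
      (by rw [Model.T, Model.PiG]; exact SemidirectCofinal.closure_inr_inf_closure_inl_eq_bot M.φ M.isProSigmaCompletion)
  have hCT := M.isCommensurablyTerminal_sup_of_section _ _ hK hS hSG hKS
  -- `D_e = N(W) = W · T`, `C(W) = W · T`, `I_e = W · T`
  have hD : (M.dpsc hne hprime).DvNode e = (M.nodeGp).map M.PiG.subtype ⊔ M.T := hN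
  refine ⟨hD.trans hC.symm, hD ▸ hCT, ?_⟩
  rw [IvNode_eq_J, hD]
  exact (inf_of_le_left le_top).symm

/-- **The cusp clause of Prop 1.3 (vii)**: `D_c = C(Π_c)` is commensurably terminal, for each of the four cusps
(`Π_c · T` for `c₁, c₂`; `Π_c · U` for `c₃, c₀`). [cite: MochizukiAbsTopII2013, Prop 1.3 (vii) p.12] -/
theorem prop13vii_cusp_dpsc (hne : Sigma.Nonempty) (hprime : ∀ p ∈ Sigma, p.Prime) (e : (M.dpsc hne hprime).Cusp) :
    (M.dpsc hne hprime).DvCusp e = Subgroup.Commensurable.commensurator ((M.dpsc hne hprime).cuspSub e) ∧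
      IsCommensurablyTerminal ((M.dpsc hne hprime).DvCusp e) := by
  rcases e with ⟨j⟩
  -- the inputs, in `P`, for `K = ι(Π_{c_j})`
  have hK : Subgroup.Commensurable.commensurator ((M.cuspGp j).map M.PiG.subtype) ⊓ M.PiG ≤ (M.cuspGp j).map M.PiG.subtype := by
    have h : Subgroup.Commensurable.commensurator ((M.cuspGp j).map M.PiG.subtype) ⊓ M.PiG.subtype.range ≤
        (M.cuspGp j).map M.PiG.subtype :=
      (isCommensurablyTerminal_subgroupOf_iff ((M.dpsc hne hprime).cuspSub_le ⟨j⟩)).mp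
        (M.isCommensurablyTerminal_cuspSub hne hprime ⟨j⟩)
    rwa [Subgroup.range_subtype] at h
  have hKG : (M.cuspGp j).map M.PiG.subtype ≤ M.PiG := Subgroup.map_subtype_le _
  -- the centralising section: `T` for `c₁, c₂`, `U` for `c₃, c₀`
  have key : ∀ S : Subgroup M.P, S ≤ Subgroup.centralizer (((M.cuspGp j).map M.PiG.subtype : Subgroup M.P) : Set M.P) →
      S ⊔ M.PiG = ⊤ → S ⊓ M.PiG = ⊥ →
      (M.dpsc hne hprime).DvCusp ⟨j⟩ = Subgroup.Commensurable.commensurator ((M.dpsc hne hprime).cuspSub ⟨j⟩) ∧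
        IsCommensurablyTerminal ((M.dpsc hne hprime).DvCusp ⟨j⟩) := by
    intro S hS hSG hSbot
    obtain ⟨hN, hC⟩ := M.decomposition_of_section _ S hK hS hSG
    have hCT := M.isCommensurablyTerminal_sup_of_section _ S hK hS hSG (M.sup_inf_PiG_eq_of_section _ S hKG hS hSbot)
    have hD : (M.dpsc hne hprime).DvCusp ⟨j⟩ = (M.cuspGp j).map M.PiG.subtype ⊔ S := hN
    exact ⟨hD.trans hC.symm, hD ▸ hCT⟩
  have hTbot : M.T ⊓ M.PiG = ⊥ := by
    rw [Model.T, Model.PiG]; exact SemidirectCofinal.closure_inr_inf_closure_inl_eq_bot M.φ M.isProSigmaCompletion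
  have hTsup : M.T ⊔ M.PiG = ⊤ := by rw [sup_comm]; exact M.PiG_sup_T
  fin_cases j
  · exact key M.U (M.U_le_centralizer_cuspGp M.twist_c_zero) M.U_sup_PiG (M.U_inf_PiG hne hprime)
  · exact key M.T (M.T_le_centralizer_cuspGp M.twist_c_one) hTsup hTbot
  · exact key M.T (M.T_le_centralizer_cuspGp M.twist_c_two) hTsup hTbot
  · exact key M.U (M.U_le_centralizer_cuspGp M.twist_c_three) M.U_sup_PiG (M.U_inf_PiG hne hprime)

/-- **[AbsTopII] Prop 1.3 (vii) (`DPSCData.Prop13vii`, F-0280) HOLDS at the two-vertex nodal DPSC datum, every `Σ`,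
no hypothesis**: `D_e = C(Π_e) = N(Π_e)` commensurably terminal in `Π_H` for the node and the four cusps, and
`I_e = D_e ∩ Π_I` for the node. [cite: MochizukiAbsTopII2013, Prop 1.3 (vii) p.12] -/
theorem prop13vii_dpsc (hne : Sigma.Nonempty) (hprime : ∀ p ∈ Sigma, p.Prime) :
    Literature.AnabelianGeometry.AbsoluteAnabelian.DPSCData.Prop13vii (M.dpsc hne hprime).toDPSCData :=
  ⟨fun e => M.prop13vii_node_dpsc hne hprime e, fun e => M.prop13vii_cusp_dpsc hne hprime e⟩

/-- **ONE DPSC datum WITH TWO VERTICES carrying the typed [AbsTopII] Prop 1.3 (i) ∧ (ii)′ ∧ (iii) ∧ (iii)′ ∧ (iv)′ ∧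
(iv)-«Moreover» ∧ (vii), for every nonempty set of primes `Σ`.** [cite: MochizukiAbsTopII2013, Prop 1.3 p.11] -/
theorem exists_twoVertex_nodal_model_vii (Sigma : Set ℕ) (hne : Sigma.Nonempty) (hprime : ∀ p ∈ Sigma, p.Prime) :
    ∃ X : DPSCIndexData.{0}, X.Sigma = Sigma ∧ (∃ v v' : X.Vert, v ≠ v' ∧ X.Adjacent v v') ∧ Nonempty X.Node ∧
      Literature.AnabelianGeometry.AbsoluteAnabelian.AbsTopII.DPSCIndexData.Prop_1_3_i X ∧
      Literature.AnabelianGeometry.AbsoluteAnabelian.AbsTopII.DPSCIndexData.Prop_1_3_ii' X ∧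
      Literature.AnabelianGeometry.AbsoluteAnabelian.DPSCData.Prop13iii X.toDPSCData ∧
      Literature.AnabelianGeometry.AbsoluteAnabelian.AbsTopII.DPSCIndexData.Prop_1_3_iii' X ∧
      Literature.AnabelianGeometry.AbsoluteAnabelian.DPSCData.Prop13iv' X.toDPSCData ∧
      Literature.AnabelianGeometry.AbsoluteAnabelian.DPSCData.Prop13iv_moreover X.toDPSCData ∧
      Literature.AnabelianGeometry.AbsoluteAnabelian.DPSCData.Prop13vii X.toDPSCData := by
  obtain ⟨M⟩ := Model.nonempty Sigma
  exact ⟨M.dpsc hne hprime, rfl, ⟨⟨(0 : Fin 2)⟩, ⟨(1 : Fin 2)⟩, M.vert_zero_ne_one hne hprime, M.adjacent_dpsc hne hprime _ _⟩,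
    ⟨⟨()⟩⟩, M.prop_1_3_i_dpsc hne hprime, M.prop_1_3_ii'_dpsc hne hprime, M.prop13iii_dpsc hne hprime,
    M.prop_1_3_iii'_dpsc hne hprime, M.prop13iv'_dpsc hne hprime, M.prop13iv_moreover_dpsc hne hprime,
    M.prop13vii_dpsc hne hprime⟩

end Literature.AnabelianGeometry.AbsoluteAnabelian.AbsTopII.TwoTripodNodal.Model

end
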